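import Mathlib.FieldTheory.Galois.Basic
import Mathlib.RingTheory.TensorProduct.Free
import Mathlib.RingTheory.IsTensorProduct
import HarnessLib

/-!
# Galois descent for base-changed algebras: the fixed points of `L ⊗_K C`

Let `L / K` be a finite Galois extension with group `Gal = Aut(L/K)` and `C` a `K`-algebra
(commutative; e.g. the coordinate ring of an affine open of a `K`-scheme). The Galois group acts
on `L ⊗_K C` through the first factor, and the **invariants are exactly `C`**:

* `exists_eq_one_tmul_of_forall_map_eq`: if `z ∈ L ⊗_K C` is fixed by all
  `σ ⊗ 1`, `σ ∈ Gal`, then `z = 1 ⊗ c` for some `c ∈ C` — in coordinates with respect to the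
  `L`-basis `1 ⊗ eᵢ` of `L ⊗_K C` given by a `K`-basis `eᵢ` of `C`, the action is `σ` on each
  coordinate, and `L^{Gal} = K` (Mathlib `IsGalois.mem_range_algebraMap_iff_fixed`);
* `mem_range_of_isPushout_of_forall_eq`: the same for any ring `D` that *is* a pushout
  `L ⊗_K C` (`Algebra.IsPushout K L C D`), with the action given by any ring endomorphisms
  `τ σ` of `D` fixing `C` and inducing `σ` on `L` (they correspond to `σ ⊗ 1`).

This is the (elementary, Speiser-type) descent statement `(X_L, 𝒪)^{Gal(L/K)} = 𝒪_X` for the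
functions on a `K`-scheme after a finite Galois base change (Görtz–Wedhorn I, §14 (Galois
descent), Prop. 14.83/Cor. 14.85 in spirit; Serre, *Local Fields*, X §2), in the form used for the
quotient of an abelian variety by a finite Galois-stable subgroup.

## References

* U. Görtz, T. Wedhorn, *Algebraic Geometry I* (2nd ed. 2020), Chapter 14 (descent).
* J.-P. Serre, *Local Fields*, Chap. X, §2 (Galois descent for vector spaces).
-/

noncomputable section

open scoped TensorProduct

namespace Literature.RingTheory.GaloisAlgebras

variable (K L : Type*) [Field K] [Field L] [Algebra K L]
variable (C : Type*) [CommRing C] [Algebra K C]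

/-- In the `L`-basis `1 ⊗ eᵢ` of `L ⊗_K C` attached to a `K`-basis `eᵢ` of `C`, the automorphism
`σ ⊗ 1` acts on coordinates by `σ` (Mathlib `Algebra.TensorProduct.basis`). [folklore] -/
theorem basis_repr_map (σ : L ≃ₐ[K] L) {ι : Type*} (b : Module.Basis ι K C) (z : L ⊗[K] C)
    (i : ι) :
    (Algebra.TensorProduct.basis L b).repr
        (Algebra.TensorProduct.map (σ : L →ₐ[K] L) (AlgHom.id K C) z) i =
      σ ((Algebra.TensorProduct.basis L b).repr z i) := by
  induction z using TensorProduct.induction_on with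
  | zero => simp
  | add x y hx hy => simp only [map_add, Finsupp.add_apply, hx, hy]
  | tmul l c =>
    simp only [Algebra.TensorProduct.map_tmul, AlgHom.id_apply,
      Algebra.TensorProduct.basis_repr_tmul, Finsupp.smul_apply, Finsupp.mapRange_apply,
      smul_eq_mul, map_mul, AlgEquiv.commutes]
    rfl

variable [FiniteDimensional K L] [IsGalois K L]

/-- **Galois descent for `L ⊗_K C`.** For `L / K` finite Galois and `C` a `K`-algebra, an element
of `L ⊗_K C` fixed by all `σ ⊗ 1`, `σ ∈ Aut(L/K)`, is of the form `1 ⊗ c`: its coordinates in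
the `L`-basis `1 ⊗ eᵢ` (`eᵢ` a `K`-basis of `C`) are `Aut(L/K)`-fixed, hence lie in `K`
(`IsGalois.mem_range_algebraMap_iff_fixed`). (Görtz–Wedhorn I, Chap. 14; Serre, *Local Fields*,
X §2, Prop. 3/Lemma 1 for vector spaces.) [folklore] -/
theorem exists_eq_one_tmul_of_forall_map_eq (z : L ⊗[K] C)
    (hz : ∀ σ : L ≃ₐ[K] L, Algebra.TensorProduct.map (σ : L →ₐ[K] L) (AlgHom.id K C) z = z) :
    ∃ c : C, z = 1 ⊗ₜ c := by
  classical
  let b := Module.Free.chooseBasis K C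
  let B := Algebra.TensorProduct.basis L b
  -- every coordinate of `z` is `Aut(L/K)`-fixed, hence comes from `K`
  have hfix : ∀ i, ∃ k : K, algebraMap K L k = B.repr z i := fun i ↦ by
    refine (IsGalois.mem_range_algebraMap_iff_fixed (B.repr z i)).mpr fun σ ↦ ?_
    rw [← basis_repr_map K L C σ b z i, hz σ]
  choose k hk using hfix
  -- the coefficient family in `K`, finitely supported
  have hk0 : ∀ i, B.repr z i = 0 → k i = 0 := fun i hi ↦ by
    apply (algebraMap K L).injective
    rw [hk i, hi, map_zero]
  let f : (Module.Free.ChooseBasisIndex K C) →₀ K :=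
    Finsupp.onFinset (B.repr z).support k fun i hi ↦ by
      rw [Finsupp.mem_support_iff]
      exact fun h ↦ hi (hk0 i h)
  have hf : ∀ i, f i = k i := fun i ↦ Finsupp.onFinset_apply
  -- the element `c = ∑ᵢ kᵢ eᵢ` has the same coordinates as `z`
  refine ⟨b.repr.symm f, B.repr.injective ?_⟩
  rw [Algebra.TensorProduct.basis_repr_tmul, one_smul, LinearEquiv.apply_symm_apply]
  ext i
  rw [Finsupp.mapRange_apply, hf, hk]

/-- **Galois descent in pushout form.** Let `D` be a `K`-algebra which is the pushout of
`L ← K → C` (`Algebra.IsPushout K L C D`, i.e. `D ≅ L ⊗_K C`), and let ring endomorphisms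
`τ σ` of `D`, `σ ∈ Aut(L/K)`, fix the image of `C` and induce `σ` on the image of `L` (so
`τ σ` corresponds to `σ ⊗ 1`). Then every common fixed point of the `τ σ` lies in the image of
`C → D`. [folklore] -/
theorem mem_range_of_isPushout_of_forall_eq {D : Type*} [CommRing D] [Algebra K D]
    [Algebra L D] [Algebra C D] [IsScalarTower K L D] [IsScalarTower K C D]
    [Algebra.IsPushout K L C D]
    (τ : (L ≃ₐ[K] L) → D →+* D) (hC : ∀ σ c, τ σ (algebraMap C D c) = algebraMap C D c)
    (hL : ∀ σ l, τ σ (algebraMap L D l) = algebraMap L D (σ l))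
    (d : D) (hd : ∀ σ, τ σ d = d) : d ∈ (algebraMap C D).range := by
  let e : L ⊗[K] C ≃ₐ[L] D := Algebra.IsPushout.equiv K L C D
  -- `τ σ` corresponds to `σ ⊗ 1`
  have hτ : ∀ (σ : L ≃ₐ[K] L) (z : L ⊗[K] C),
      τ σ (e z) = e (Algebra.TensorProduct.map (σ : L →ₐ[K] L) (AlgHom.id K C) z) := by
    intro σ z
    induction z using TensorProduct.induction_on with
    | zero => simp
    | add x y hx hy => rw [map_add, map_add, hx, hy, map_add, map_add]
    | tmul l c =>
      rw [Algebra.TensorProduct.map_tmul, Algebra.IsPushout.equiv_tmul,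
        Algebra.IsPushout.equiv_tmul, map_mul, hC, hL]
      rfl
  obtain ⟨z, rfl⟩ : ∃ z, e z = d := e.surjective d
  have hz : ∀ σ : L ≃ₐ[K] L,
      Algebra.TensorProduct.map (σ : L →ₐ[K] L) (AlgHom.id K C) z = z := fun σ ↦
    e.injective (by rw [← hτ, hd])
  obtain ⟨c, rfl⟩ := exists_eq_one_tmul_of_forall_map_eq K L C z hz
  exact ⟨c, by rw [Algebra.IsPushout.equiv_tmul, map_one, one_mul]⟩

end Literature.RingTheory.GaloisAlgebras
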